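import Mathlib
import Summits.Ventures.HodgeRepro.CMFieldGalois
import Summits.Ventures.HodgeRepro.CMHodge

/-!
# Hodge structures of CM type, Galois case: embeddings as group elements and the Galois orbit of `μ`

Blind re-derivation cell `pub-hodge-repro`, seat `typer-2`.  Built on `CMFieldGalois.lean` (`embEquiv`)
and `CMHodge.lean` (`splitEquiv`, `weightSpace`, `cochar`).

For `K/ℚ` Galois with a base embedding `φ₀ : K →+* ℂ`, `Hom_ℚ(K, ℂ) ≅ Gal(K/ℚ)` (`galEquivAlgHom`,
`g ↦ φ₀ ∘ g`), so a set of embeddings `Φ` is the same as a subset `Φ' ⊆ Gal(K/ℚ)` (`toGalSet`) and the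
Galois conjugate `σ ∘ Φ` of a set of embeddings (`Aut(ℂ)` acting through `Gal(K/ℚ)` on the left) is the
left translate `s • Φ'` of the finite-group model (`CMType.lean`, `Hecke.lean`).  This file records the
dictionary between `CMHodge.lean` (embeddings) and the group model:

* `galEquivAlgHom K φ₀ : (K ≃ₐ[ℚ] K) ≃ (K →ₐ[ℚ] ℂ)` and `toGalSet φ₀ Φ := galEquivAlgHom ⁻¹' Φ`;
* `mem_toGalSet`, `toGalSet_compl`;
* `smulSet φ₀ s Φ` — the set of embeddings `φ₀ ∘ s ∘ g`, `g ∈ Φ'` (the conjugate `sΦ`), with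
  `toGalSet_smulSet : toGalSet (s Φ) = s • toGalSet Φ` (conjugating a set of embeddings is left
  translation in the model), so the Galois orbit of the cocharacter `μ_Φ` of `CMHodge.lean` is indexed by
  the left translates `s • Φ'` — the cocharacters whose `ℤ`-span is the Mumford–Tate lattice of
  `MTLattice.lean`.
-/

open scoped Pointwise

namespace HodgeRepro.CMHodge

variable (K : Type*) [Field K] [NumberField K] [IsGalois ℚ K] (φ₀ : K →+* ℂ)

/-- `Gal(K/ℚ) ≃ Hom_ℚ(K, ℂ)`, `g ↦ φ₀ ∘ g` (the `ℚ`-algebra version of `CMGalois.embEquiv`). -/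
noncomputable def galEquivAlgHom : (K ≃ₐ[ℚ] K) ≃ (K →ₐ[ℚ] ℂ) :=
  (CMGalois.embEquiv K φ₀).trans RingHom.equivRatAlgHom

/-- `galEquivAlgHom K φ₀ g x = φ₀ (g x)`. -/
theorem galEquivAlgHom_apply (g : K ≃ₐ[ℚ] K) (x : K) : galEquivAlgHom K φ₀ g x = φ₀ (g x) := rfl

variable {K}

/-- The subset of `Gal(K/ℚ)` corresponding to a set of embeddings `Φ`. -/
def toGalSet (Φ : Set (K →ₐ[ℚ] ℂ)) : Set (K ≃ₐ[ℚ] K) := galEquivAlgHom K φ₀ ⁻¹' Φ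

/-- `g ∈ toGalSet φ₀ Φ ↔ φ₀ ∘ g ∈ Φ`. -/
theorem mem_toGalSet {Φ : Set (K →ₐ[ℚ] ℂ)} {g : K ≃ₐ[ℚ] K} :
    g ∈ toGalSet φ₀ Φ ↔ galEquivAlgHom K φ₀ g ∈ Φ := Iff.rfl

/-- Complements correspond. -/
theorem toGalSet_compl (Φ : Set (K →ₐ[ℚ] ℂ)) : toGalSet φ₀ Φᶜ = (toGalSet φ₀ Φ)ᶜ := rfl

/-- The set of embeddings is recovered from its group-model set. -/
theorem image_toGalSet (Φ : Set (K →ₐ[ℚ] ℂ)) : galEquivAlgHom K φ₀ '' toGalSet φ₀ Φ = Φ :=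
  (galEquivAlgHom K φ₀).image_preimage Φ

/-- The conjugate `s ∘ Φ` of a set of embeddings by `s ∈ Gal(K/ℚ)` (through the base point:
`φ₀ ∘ g ↦ φ₀ ∘ s ∘ g`). -/
def smulSet (s : K ≃ₐ[ℚ] K) (Φ : Set (K →ₐ[ℚ] ℂ)) : Set (K →ₐ[ℚ] ℂ) :=
  galEquivAlgHom K φ₀ '' (s • toGalSet φ₀ Φ)

/-- **Conjugating a set of embeddings is left translation in the group model**:
`toGalSet (s Φ) = s • toGalSet Φ`. -/
theorem toGalSet_smulSet (s : K ≃ₐ[ℚ] K) (Φ : Set (K →ₐ[ℚ] ℂ)) :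
    toGalSet φ₀ (smulSet φ₀ s Φ) = s • toGalSet φ₀ Φ := by
  unfold smulSet
  show galEquivAlgHom K φ₀ ⁻¹' (galEquivAlgHom K φ₀ '' (s • toGalSet φ₀ Φ)) = s • toGalSet φ₀ Φ
  rw [Equiv.preimage_image]

/-- `φ₀ ∘ s ∘ g ∈ s Φ ↔ φ₀ ∘ g ∈ Φ`. -/
theorem galEquivAlgHom_mul_mem_smulSet_iff (s g : K ≃ₐ[ℚ] K) (Φ : Set (K →ₐ[ℚ] ℂ)) :
    galEquivAlgHom K φ₀ (s * g) ∈ smulSet φ₀ s Φ ↔ galEquivAlgHom K φ₀ g ∈ Φ := by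
  rw [← mem_toGalSet, toGalSet_smulSet, ← smul_eq_mul, Set.smul_mem_smul_set_iff, mem_toGalSet]

/-- The weight space of a conjugate set of embeddings, read in the group model: `v ∈ ℂ^{sΦ}` iff `v`
vanishes on the embeddings `φ₀ ∘ g` with `g ∉ s • Φ'`. -/
theorem mem_weightSpace_smulSet_iff (s : K ≃ₐ[ℚ] K) (Φ : Set (K →ₐ[ℚ] ℂ)) (v : (K →ₐ[ℚ] ℂ) → ℂ) :
    v ∈ weightSpace (smulSet φ₀ s Φ) ↔
      ∀ g : K ≃ₐ[ℚ] K, g ∉ s • toGalSet φ₀ Φ → v (galEquivAlgHom K φ₀ g) = 0 := by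
  rw [mem_weightSpace, ← (galEquivAlgHom K φ₀).forall_congr_right]
  refine forall_congr' fun g => ?_
  rw [← mem_toGalSet, toGalSet_smulSet]

end HodgeRepro.CMHodge
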